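import Summits.SmoothPoincare4.SmoothPoincare4.Theses.EntropyRung
import Summits.SmoothPoincare4.SmoothPoincare4.Theses.WeylBudget
import Summits.SmoothPoincare4.SmoothPoincare4.Theorems.ChangGurskyYang.Negative.WithoutCompactFalse
import Summits.SmoothPoincare4.SmoothPoincare4.Theorems.ChangGurskyYang.Negative.WithoutSimplyConnectedFalse
import Literature.Geometry.Riemannian.ChernGaussBonnetFour
import Literature.Geometry.Lorentzian.WeylConformal
import HarnessLib

/-!
# Line `gv-continuity-path` for crux `EntropyRung.ChangGurskyYang` (item stmt-SmoothPoincare4-10834)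

CRUX-PLAN SKELETON (planner `planner-cruxplan-stmt-SmoothPoincare4-10834-gv-continuity-path-0`,
2026-08-16; idea cards `gv-continuity-path` ⊕ `gv-weyl-shifted-path`, merged by triage r1-1/2/3).

The crux is VERBATIM the named fact `changGurskyYang_sphere_four` (Chang–Gursky–Yang 2003, Thm. A,
simply connected `scal > 0` case; `Disproof.crux_iff_fact`). The line proves it along CGY §2 with the
THREE leaves of the tree's reduction, the PDE leaf (CGY Thm. 1.4, `α = 1`) being re-engined by the
Gursky–Viaclovsky positive-exponent continuity path CARRYING THE WEYL WEIGHT (GV 2003,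
arXiv:math/0301350, Thm. 1 / (PDE) / Props. 2–6 / §5, with `ψ_W = (1/16)|W_g|²_g` as an `x`-only term):

  `σ₂(g⁻¹A^t_u) = ψ_W + f² e^{4u}`,  `g̃ = e^{−2u} g`,  `A^t = ½(Ric − (t/6) R g)`,  `t ∈ [δ, 1]`.

Read on the conformal metric `h = e^{−2u} g` itself (both `σ₂` and `|W|²` pick up `e^{4u}`), the
equation is `pathOperator h t = q · e^{8u}` with `q = 4f²` and
`pathOperator h t := σ₂(A_h) − ¼|W_h|² + (1−t)(2−t) R_h²/6` (tree normalisation `A = Ric − (R/6)g`,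
`σ₂(A) = 4σ₂(A¹_GV)`, `(0,4)`-norm `|W|²`); at `t = 1` a solution IS a conformal metric with
`σ₂(A_h) − ¼|W_h|² > 0` and `R_h > 0` — the pointwise pinching Margerin's theorem consumes.

STUBS (6, registered; `sorry` lives only there): `stub_margerin` (Margerin 1998 Thm. 1 = `hMargerin`
verbatim) · `stub_chernGaussBonnet` (= the Literature named fact `chernGaussBonnet_four`, by name; it
also yields the conformal invariance of `∫σ₂(A) dV`, `sigma2WeylSchoutenIntegral_conformal`, PROVED
here from it + `weylEnergy_conformal_sq_four`) · `stub_pathStart` (`R_g > 0` ⇒ the path starts: `pathOperator g δ > 0`, smooth, for some `δ ≤ 1`) ·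
`stub_pathApriori` (uniform `C²` bound along the path for solutions with `κ(h) ≥ κ₀ > 0`; GV Props.
3–6 with the weight, Chen 2005 Thm. 1(a) — the HARDEST stub) · `stub_pathOpen` (GV Prop. 2 +
implicit function theorem + elliptic regularity) · `stub_pathClosed` (Evans–Krylov + Schauder +
Arzelà–Ascoli: compactness of the solution space from `C²` bounds).

COMPOSITION (kernel-checked, no `sorry` outside the stubs): `thm14Psc_of_path` (the continuity
method: `𝒮 ∩ [δ,1]` is closed and relatively open, `δ ∈ 𝒮`, hence `1 ∈ 𝒮`, Mathlib's
`IsClosed.mem_of_ge_of_forall_exists_gt`; `κ` is constant along solutions by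
`sigma2WeylSchoutenIntegral_conformal` + the PROVED `weylEnergy_conformal_sq_four`) proves the
conclusion of Disproof §7's `Thm14LeafPsc` at `(M, g)`; `ChangGurskyYang_of : ChangGurskyYang` is then CGY §2 (tree
lemmas `quarter_weylEnergy_lt_of_chernGaussBonnet`, `weakPinching_lt_of_sigma2WeylSchouten_gt`,
`IsRealProjectiveSpace.not_simplyConnectedSpace`) — the crux BY NAME, closed modulo the six stubs,
each consumed at its use site with exactly its registered statement. (The `S₁ → … → S₆ → Crux`
spelling with the statements as named hypotheses would need `@[stub]`-tagged statement constants,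
a gate-reserved attribute; the closed-modulo-stubs spelling is the one `#h21_check_skeleton` audits.)

DISPROOF USED (Disproof.lean gen 2, 1001 lines, re-read 2026-08-16T02:10Z): §0 `crux_iff_fact`;
§3a `changGurskyYang_false_without_compact` (LANDED `Negative/WithoutCompactFalse.lean`, imported
here) — `[CompactSpace M]` is carried by EVERY stub and used at `stub_pathStart` (uniform `δ`),
`stub_pathApriori` (max/min points, finite volume, Harnack), `stub_pathClosed` (Arzelà–Ascoli),
`stub_pathOpen` (Fredholm theory on a closed manifold), `stub_margerin`, `stub_chernGaussBonnet`;
§3b `changGurskyYang_false_without_simplyConnected` (LANDED, imported here) — `π₁ = 1` enters only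
in the final `∨ ℝP⁴` exclusion, every PDE stub is over connected `M` and `stub_margerin` concludes
`S⁴ ∨ ℝP⁴`, so the `ℝℙ⁴` witness passes through honestly; §7 `thm14Leaf_false` (PAPER: `hThm14`
verbatim is false without `[ConnectedSpace M]`) — this line never states `hThm14`: it proves the
`Thm14LeafPsc` shape (connected, `scal > 0` in/out), and `[ConnectedSpace M]` is used exactly in
`stub_pathApriori` (Harnack from `max u` to `min u`); §4/§3d thresholds (`ℂP²`: `κ = 0`;
`S²×S²`: `κ < 0`) — `κ > 0` is consumed once, as the hypothesis `κ₀ ≤ kappa h` of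
`stub_pathApriori`; §5 junk — every stub carries `IsRiemannian`; §8 — `R > 0` strict is used at the
start of the path only. Negatives index (`ledger negatives --problem SmoothPoincare4`): 0 entries.
-/

noncomputable section

open scoped Manifold ContDiff Topology ENNReal
open Set Filter
open Literature.Geometry.Lorentzian (PseudoRiemannianMetric riemannianMeasure)
open Literature.Geometry.Lorentzian.PseudoRiemannianMetric
open Literature.Geometry.Riemannian
open Literature.Topology.FourManifolds
open Summit.SmoothPoincare4.SmoothPoincare4.Theses.EntropyRung (ChangGurskyYang)

namespace Summit.SmoothPoincare4.SmoothPoincare4.Cruxes.ChangGurskyYang.GvContinuityPath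

set_option linter.dupNamespace false
set_option linter.unusedVariables false

/-! ## Vocabulary of the line (4 definitions over tree declarations only; sorry-free)

A lead who wants stubs closed by SEPARATE `--supports` proposals lands this block verbatim first
(definitions file; a definition request is filed on the crux item), so that the registered stub
signatures resolve tree-side; otherwise the stubs are closed inside this file. -/

/-- **The Weyl-weighted Gursky–Viaclovsky path operator, read on the conformal metric itself**:
`P_t(h)(x) = σ₂(A_h)(x) − ¼|W_h|²(x) + (1−t)(2−t)·R_h(x)²/6`, with the tree's
`A = Ric − (R/6)g`, `σ₂(A) = −½|E|² + R²/24` (`sigma2WeylSchouten`), `(0,4)`-norm `|W|²`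
(`weylNormSq`). For `h = e^{−2u}g` this is `4e^{4u}·[σ₂(g⁻¹A^t_u) − (1/16)|W_g|²_g]` in GV's
notation (`σ₂(A^t) = σ₂(A¹) + (1−t)(2−t)R²/24`, GV 2003 Prop. 4 proof; both `σ₂` and `|W|²` have
conformal weight `e^{4u}`), so GV's weighted equation `σ₂(g⁻¹A^t_u) = (1/16)|W_g|² + f²e^{4u}` reads
`P_t(h) = q·e^{8u}`, `q = 4f²`. At `t = 1`: `P_1(h) = σ₂(A_h) − ¼|W_h|²`.
[cite: GurskyViaclovsky2003, (PDE) and Prop. 4] -/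
def pathOperator {M : Type} [TopologicalSpace M] [ChartedSpace (EuclideanSpace ℝ (Fin 4)) M]
    [IsManifold (𝓡 4) ∞ M]
    (h : PseudoRiemannianMetric (𝓡 4) ∞ (EuclideanSpace ℝ (Fin 4)) (TangentSpace (𝓡 4) : M → Type _))
    [h.HasLeviCivita] (t : ℝ) (x : M) : ℝ :=
  h.sigma2WeylSchouten x - 1 / 4 * h.weylNormSq x + (1 - t) * (2 - t) * h.scalarCurvature x ^ 2 / 6

/-- **A smooth admissible solution of the weighted path equation at parameter `t`** with right-hand
side `q` on the background `g`: a Riemannian metric `h` CONFORMAL to `g` with factor `e^{−2u}`, `u`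
smooth, of positive scalar curvature (`A^t_u ∈ Γ₂⁺`: given `σ₂ > 0`, membership in GV's cone is
`σ₁(h⁻¹A^t_h) = (3−2t)R_h/6 > 0`, i.e. `R_h > 0` for `t ≤ 1`), solving `P_t(h) = q·e^{8u}`
pointwise. [cite: GurskyViaclovsky2003, §5, the set 𝒮] -/
def IsPathSolution {M : Type} [TopologicalSpace M] [ChartedSpace (EuclideanSpace ℝ (Fin 4)) M]
    [IsManifold (𝓡 4) ∞ M]
    (g h : PseudoRiemannianMetric (𝓡 4) ∞ (EuclideanSpace ℝ (Fin 4)) (TangentSpace (𝓡 4) : M → Type _))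
    [h.HasLeviCivita] (u : M → ℝ) (t : ℝ) (q : M → ℝ) : Prop :=
  h.IsRiemannian ∧ ContMDiff (𝓡 4) 𝓘(ℝ) ∞ u ∧
    (∀ (x : M) (v w : TangentSpace (𝓡 4) x), h.val x v w = Real.exp (-2 * u x) * g.val x v w) ∧
    (∀ x : M, 0 < h.scalarCurvature x) ∧
    ∀ x : M, pathOperator h t x = q x * Real.exp (8 * u x)

/-- **GV's solvable set**: `t ∈ 𝒮` iff the weighted path equation at `t` has a smooth admissible
solution (a `C^∞` metric `h = e^{−2u}g` with its Levi-Civita connection).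
[cite: GurskyViaclovsky2003, §5, the set 𝒮] -/
def Solvable {M : Type} [TopologicalSpace M] [ChartedSpace (EuclideanSpace ℝ (Fin 4)) M]
    [IsManifold (𝓡 4) ∞ M]
    (g : PseudoRiemannianMetric (𝓡 4) ∞ (EuclideanSpace ℝ (Fin 4)) (TangentSpace (𝓡 4) : M → Type _))
    (t : ℝ) (q : M → ℝ) : Prop :=
  ∃ (h : PseudoRiemannianMetric (𝓡 4) ∞ (EuclideanSpace ℝ (Fin 4)) (TangentSpace (𝓡 4) : M → Type _))
    (_ : h.HasLeviCivita) (u : M → ℝ), IsPathSolution g h u t q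

/-- **CGY's conformal invariant (1.2)**: `κ(h) = ∫σ₂(A_h) dV_h − ¼ ∫|W_h|² dV_h` (a real number;
`weylEnergy < ⊤` on closed manifolds). [cite: ChangGurskyYang2003, (1.2) p. 111] -/
def kappa {M : Type} [TopologicalSpace M] [T2Space M] [ChartedSpace (EuclideanSpace ℝ (Fin 4)) M]
    [IsManifold (𝓡 4) ∞ M]
    (h : PseudoRiemannianMetric (𝓡 4) ∞ (EuclideanSpace ℝ (Fin 4)) (TangentSpace (𝓡 4) : M → Type _))
    [h.HasLeviCivita] : ℝ :=
  h.sigma2WeylSchoutenIntegral - 1 / 4 * h.weylEnergy.toReal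

/-! ## The six registered stubs (`sorry` lives ONLY here) -/

/-- STUB 1 = Margerin 1998, Thm. 1 (`hMargerin` of the tree's reductions, `Disproof.MargerinLeaf`,
VERBATIM): closed connected `M⁴`, `R > 0`, weak pinching `WP < 1/6` pointwise ⇒ `S⁴` or standard
`ℝP⁴`. TRUE in print; strictness of `<` is load-bearing (`S³×S¹`, `ℂP²`: `Disproof.MargerinLeafNonStrict`
PAPER-false). Size XL (Ricci flow with weakly pinched curvature), shared by every line of this crux.
[cite: Margerin1998, Thm. 1] -/
theorem stub_margerin :
    ∀ (M : Type) [TopologicalSpace M] [T2Space M] [SecondCountableTopology M]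
      [ChartedSpace (EuclideanSpace ℝ (Fin 4)) M] [IsManifold (𝓡 4) ∞ M] [CompactSpace M]
      [ConnectedSpace M]
      (g : PseudoRiemannianMetric (𝓡 4) ∞ (EuclideanSpace ℝ (Fin 4)) (TangentSpace (𝓡 4) : M → Type _))
      [g.HasLeviCivita], g.IsRiemannian → (∀ x, 0 < g.scalarCurvature x) →
      (∀ x, g.weakPinching x < 1 / 6) →
      Nonempty (M ≃ₘ⟮𝓡 4, 𝓡 4⟯ Metric.sphere (0 : EuclideanSpace ℝ (Fin 5)) 1) ∨
        IsRealProjectiveSpace 4 M := by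
  sorry

/-- STUB 2 = the Chern–Gauss–Bonnet formula in dimension four, BY NAME of the tree's named fact
`chernGaussBonnet_four` (`8π²χ(M) = ¼∫|W|² + ∫σ₂(A)` for every closed smooth Riemannian 4-manifold,
`χ = relEuler ℤ ℤ M ∅`; Besse 1987, 6.31; CGY 2003 (1.1)). A citation leaf: size XL as a
formalisation (Chern–Weil + de Rham), zero mathematical risk; shared by every line.
[cite: Besse1987, 6.31] [cite: ChangGurskyYang2003, (1.1) p. 111] -/
theorem stub_chernGaussBonnet : chernGaussBonnet_four := by
  sorry

/-- **Conformal invariance of `∫σ₂(A) dV` on closed 4-manifolds, FROM STUB 2** (CGY 2003,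
p. 111: "the conformal invariance of the Weyl tensor implies that the quantity `∫σ₂(A) dvol` is
conformally invariant as well"; GV 2003, (1.3)–(1.5)): for `g' = ψ²g`, `ψ > 0` smooth,
`∫σ₂(A_{g'})dV_{g'} = 8π²χ(M) − ¼∫|W_{g'}|² = 8π²χ(M) − ¼∫|W_g|² = ∫σ₂(A_g)dV_g` by Chern–Gauss–Bonnet
(STUB 2, both metrics) and the PROVED conformal invariance of the Weyl energy
(`weylEnergy_conformal_sq_four`). (A direct, CGB-free proof — `σ₂(A_{e^{-2u}g})e^{-4u} − σ₂(A_g)` is a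
divergence, Viaclovsky 2000 / Chang–Yang — is an L-sized alternative a lead may land as a helper to
make the PDE half independent of STUB 2; it is not a registered stub.) With it, `κ` is a conformal
invariant. [cite: ChangGurskyYang2003, p. 111] [cite: GurskyViaclovsky2003, (1.3)–(1.5)] -/
theorem sigma2WeylSchoutenIntegral_conformal
    {M : Type} [TopologicalSpace M] [T2Space M] [SecondCountableTopology M]
    [ChartedSpace (EuclideanSpace ℝ (Fin 4)) M] [IsManifold (𝓡 4) ∞ M] [CompactSpace M]
    (g g' : PseudoRiemannianMetric (𝓡 4) ∞ (EuclideanSpace ℝ (Fin 4)) (TangentSpace (𝓡 4) : M → Type _))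
    [g.HasLeviCivita] [g'.HasLeviCivita] (hg : g.IsRiemannian)
    {ψ : M → ℝ} (hψ : ContMDiff (𝓡 4) 𝓘(ℝ) ∞ ψ) (hpos : ∀ x, 0 < ψ x)
    (hgg' : ∀ (x : M) (v w : TangentSpace (𝓡 4) x), g'.val x v w = ψ x ^ 2 * g.val x v w) :
    g'.sigma2WeylSchoutenIntegral = g.sigma2WeylSchoutenIntegral := by
  letI : MeasurableSpace M := borel M
  haveI : BorelSpace M := ⟨rfl⟩
  have hg' : g'.IsRiemannian := fun y v hv ↦ by
    rw [hgg']
    exact mul_pos (pow_pos (hpos y) 2) (hg y v hv)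
  have h1 := stub_chernGaussBonnet M g hg
  have h2 := stub_chernGaussBonnet M g' hg'
  have h3 : g'.weylEnergy = g.weylEnergy := weylEnergy_conformal_sq_four g g' hg hψ hpos hgg'
  rw [h3] at h2
  linarith

/-- STUB 3 = the path STARTS (GV 2003, §3 ¶1: "Since `R_g > 0`, there exists `δ > −∞` so that
`A^δ_g` is positive definite … `u ≡ 0` is a solution for `t = δ`", with the Weyl weight): on a
closed `M⁴` with `R_g > 0` there is `δ ≤ 1` with `P_δ(g) = σ₂(A_g) − ¼|W_g|² + (1−δ)(2−δ)R_g²/6 > 0`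
pointwise (`R ≥ R_min > 0` by compactness, the first two terms are bounded, `(1−δ)(2−δ) → ∞`), and
`P_δ(g)` is smooth (`|W|²`, `σ₂(A) = −½|E|² + R²/24` are smooth functions of a smooth metric) — so
`q := P_δ(g)` is an admissible right-hand side and `(h, u) = (g, 0)` solves at `t = δ`
(`isPathSolution_start`). Size M. [cite: GurskyViaclovsky2003, §3] -/
theorem stub_pathStart :
    ∀ (M : Type) [TopologicalSpace M] [T2Space M] [SecondCountableTopology M]
      [ChartedSpace (EuclideanSpace ℝ (Fin 4)) M] [IsManifold (𝓡 4) ∞ M] [CompactSpace M]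
      (g : PseudoRiemannianMetric (𝓡 4) ∞ (EuclideanSpace ℝ (Fin 4)) (TangentSpace (𝓡 4) : M → Type _))
      [g.HasLeviCivita], g.IsRiemannian → (∀ x, 0 < g.scalarCurvature x) →
      ∃ δ : ℝ, δ ≤ 1 ∧ ContMDiff (𝓡 4) 𝓘(ℝ) ∞ (fun x ↦ pathOperator g δ x) ∧
        ∀ x, 0 < pathOperator g δ x := by
  sorry

/-- STUB 4 = the A-PRIORI ESTIMATE along the weighted path (GV 2003 Props. 3–6 with `ψ_W`; the
local `C¹`–`C²` estimate for a general right side `f(x,u)` is S. Chen, IMRN 2005:55, Thm. 1(a) +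
Cor. 2; Guan–Wang 2003; Li–Li 2003): on a closed CONNECTED `(M⁴, g)`, for a smooth positive right
side `q`, `δ ≤ 1` and `κ₀ > 0` there is `C = C(M, g, q, δ, κ₀)` bounding `|u|`, `|∇u|²_g = g.gradSq u`
and `|∇²u|²_g = g.normSq (g.hessian u)` for every smooth admissible solution `(h = e^{−2u}g, u)` at
any `t ∈ [δ, 1]` whose conformal invariant satisfies `κ(h) ≥ κ₀`. Ingredients: sup bound (GV Prop. 3:
at `max u`, `(q/4)e^{4u} ≤ σ₂(g⁻¹A^t_u) ≤ (3/8)σ₁(g⁻¹A^t_u)² ≤ (3/8)σ₁(g⁻¹A^t_g)²` — Maclaurin, the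
weight only helps), inf bound (GV Prop. 4: integrating the equation against `dV_h = e^{−4u}dV_g`,
`∫ (q/4) e^{4u} dV_g = ¼κ(h) + (1−t)(2−t)/24 ∫R_h² dV_h ≥ ¼κ₀`, then Harnack from `max u` to `min u`
along a path — CONNECTEDNESS, cf. `Disproof.thm14Leaf_false`), `C¹` (GV Prop. 5 / Chen 2005 with
the `x`-dependent weight), `C²` (GV Prop. 6: Guan–Wang / Chen local estimates, `σ₂^{1/2}` concave).
Size XL — the HARDEST stub. [cite: GurskyViaclovsky2003, Props. 3–6] [cite: Chen2005, Thm. 1(a)] -/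
theorem stub_pathApriori :
    ∀ (M : Type) [TopologicalSpace M] [T2Space M] [SecondCountableTopology M]
      [ChartedSpace (EuclideanSpace ℝ (Fin 4)) M] [IsManifold (𝓡 4) ∞ M] [CompactSpace M]
      [ConnectedSpace M]
      (g : PseudoRiemannianMetric (𝓡 4) ∞ (EuclideanSpace ℝ (Fin 4)) (TangentSpace (𝓡 4) : M → Type _))
      [g.HasLeviCivita], g.IsRiemannian →
      ∀ (q : M → ℝ) (δ κ₀ : ℝ), ContMDiff (𝓡 4) 𝓘(ℝ) ∞ q → (∀ x, 0 < q x) → δ ≤ 1 → 0 < κ₀ →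
      ∃ C : ℝ, ∀ t : ℝ, δ ≤ t → t ≤ 1 →
        ∀ (h : PseudoRiemannianMetric (𝓡 4) ∞ (EuclideanSpace ℝ (Fin 4)) (TangentSpace (𝓡 4) : M → Type _))
          [h.HasLeviCivita] (u : M → ℝ), IsPathSolution g h u t q → κ₀ ≤ kappa h →
          ∀ x, |u x| ≤ C ∧ g.gradSq u x ≤ C ∧ g.normSq x (g.hessian u x) ≤ C := by
  sorry

/-- STUB 5 = OPENNESS of the solvable set below `t = 1` (GV 2003, Prop. 2 + §5: at a smooth
admissible solution the linearisation `L^t(g⁻¹A^t_u)_{ij}∇²_{ij} + (first order) − ∂_u RHS` is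
elliptic for `t ≤ 1` (`L^t = T₁ + ((1−t)/2)σ₁(T₁)·I > 0` on `Γ₂⁺`) with zeroth-order coefficient
`−∂_u(ψ_W + (q/4)e^{4u})^{1/2} = −(q/2)e^{4u}(ψ_W + (q/4)e^{4u})^{−1/2} < 0` — the `u`-independent
weight drops out — hence invertible `C^{2,α} → C^α` by the maximum principle + Fredholm index `0`;
the Banach-space implicit function theorem gives `C^{2,α}` solutions for `|t − t₀| < ε`, smooth by
elliptic regularity, admissible by continuity (`Γ₂⁺` open)). Size L–XL (Hölder spaces and Schauder
theory on a closed manifold are not in the tree; the IFT is Mathlib's).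
[cite: GurskyViaclovsky2003, Prop. 2 and §5] -/
theorem stub_pathOpen :
    ∀ (M : Type) [TopologicalSpace M] [T2Space M] [SecondCountableTopology M]
      [ChartedSpace (EuclideanSpace ℝ (Fin 4)) M] [IsManifold (𝓡 4) ∞ M] [CompactSpace M]
      [ConnectedSpace M]
      (g : PseudoRiemannianMetric (𝓡 4) ∞ (EuclideanSpace ℝ (Fin 4)) (TangentSpace (𝓡 4) : M → Type _))
      [g.HasLeviCivita], g.IsRiemannian →
      ∀ (q : M → ℝ), ContMDiff (𝓡 4) 𝓘(ℝ) ∞ q → (∀ x, 0 < q x) →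
      ∀ t₀ : ℝ, t₀ ≤ 1 → Solvable g t₀ q →
        ∃ ε : ℝ, 0 < ε ∧ ∀ t : ℝ, t₀ - ε < t → t < t₀ + ε → t ≤ 1 → Solvable g t q := by
  sorry

/-- STUB 6 = CLOSEDNESS, i.e. compactness of the solution space from `C²` bounds (GV 2003, Prop. 6
and §5): along `t_k → t` (`t_k ≤ 1`), smooth admissible solutions with `|u_k|, |∇u_k|²_g, |∇²u_k|²_g ≤ C`
have a smooth admissible solution at `t` in their closure — the `C²` bound makes the concave equation
uniformly elliptic (`σ₂(g⁻¹A^{t_k}_{u_k}) ≥ (q/4)e^{4u_k} ≥ (min q/4)e^{−4C} > 0`, `|A^{t_k}_{u_k}| ≤ C'`),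
Evans–Krylov gives `C^{2,α}` bounds, Schauder bootstraps to every `C^m`, Arzelà–Ascoli extracts a
`C^∞` limit `u`, and `h = e^{−2u}g` (with its Levi-Civita connection) solves at `t`; admissibility
of the limit: `σ₂ > 0` forces `σ₁² = |A|² + 2σ₂ > 0`, so `σ₁ = lim σ₁(A^{t_k}_{u_k}) ≥ 0` is `> 0`,
i.e. `R_h > 0`. Size L–XL (Evans–Krylov–Schauder theory absent from Mathlib).
[cite: GurskyViaclovsky2003, Prop. 6 and §5] [cite: Evans1982] [cite: Krylov1984] -/
theorem stub_pathClosed :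
    ∀ (M : Type) [TopologicalSpace M] [T2Space M] [SecondCountableTopology M]
      [ChartedSpace (EuclideanSpace ℝ (Fin 4)) M] [IsManifold (𝓡 4) ∞ M] [CompactSpace M]
      [ConnectedSpace M]
      (g : PseudoRiemannianMetric (𝓡 4) ∞ (EuclideanSpace ℝ (Fin 4)) (TangentSpace (𝓡 4) : M → Type _))
      [g.HasLeviCivita], g.IsRiemannian →
      ∀ (q : M → ℝ) (C : ℝ), ContMDiff (𝓡 4) 𝓘(ℝ) ∞ q → (∀ x, 0 < q x) →
      ∀ (s : ℕ → ℝ) (t : ℝ), Tendsto s atTop (𝓝 t) → (∀ k, s k ≤ 1) →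
        (∀ k, ∃ (h : PseudoRiemannianMetric (𝓡 4) ∞ (EuclideanSpace ℝ (Fin 4)) (TangentSpace (𝓡 4) : M → Type _))
          (_ : h.HasLeviCivita) (u : M → ℝ), IsPathSolution g h u (s k) q ∧
            ∀ x, |u x| ≤ C ∧ g.gradSq u x ≤ C ∧ g.normSq x (g.hessian u x) ≤ C) →
        Solvable g t q := by
  sorry

/-! ## Composition (no `sorry` below this line; the stubs are consumed by name) -/

section Composition

variable {M : Type} [TopologicalSpace M] [T2Space M] [SecondCountableTopology M]
  [ChartedSpace (EuclideanSpace ℝ (Fin 4)) M] [IsManifold (𝓡 4) ∞ M] [CompactSpace M]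

omit [T2Space M] [SecondCountableTopology M] [CompactSpace M] in
/-- `(g, u ≡ 0)` solves the path equation at `t = δ` with right side `q = P_δ(g)` (GV §3: "`u ≡ 0`
is a solution of (path) for `t = δ`"). [cite: GurskyViaclovsky2003, §3] -/
theorem isPathSolution_start
    (g : PseudoRiemannianMetric (𝓡 4) ∞ (EuclideanSpace ℝ (Fin 4)) (TangentSpace (𝓡 4) : M → Type _))
    [g.HasLeviCivita] (hg : g.IsRiemannian) (hR : ∀ x, 0 < g.scalarCurvature x) (δ : ℝ) :
    IsPathSolution g g (fun _ ↦ 0) δ (fun x ↦ pathOperator g δ x) := by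
  refine ⟨hg, contMDiff_const, fun x v w ↦ ?_, hR, fun x ↦ ?_⟩
  · simp
  · simp

/-- **`κ` is constant along solutions**: for a solution `h = e^{−2u}g`, `κ(h) = κ(g)` — conformal
invariance of `∫σ₂(A)` (`sigma2WeylSchoutenIntegral_conformal`, from STUB 2, with `ψ = e^{−u}`)
and of `∫|W|²` (PROVED in the tree, `weylEnergy_conformal_sq_four`). [cite: ChangGurskyYang2003, p. 111] -/
theorem kappa_eq_of_isPathSolution
    (g h : PseudoRiemannianMetric (𝓡 4) ∞ (EuclideanSpace ℝ (Fin 4)) (TangentSpace (𝓡 4) : M → Type _))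
    [g.HasLeviCivita] [h.HasLeviCivita] (hg : g.IsRiemannian) {u : M → ℝ} {t : ℝ} {q : M → ℝ}
    (hsol : IsPathSolution g h u t q) : kappa h = kappa g := by
  obtain ⟨-, hu, hconf, -, -⟩ := hsol
  letI : MeasurableSpace M := borel M
  haveI : BorelSpace M := ⟨rfl⟩
  have hψ : ContMDiff (𝓡 4) 𝓘(ℝ) ∞ (fun x ↦ Real.exp (-u x)) :=
    Real.contDiff_exp.comp_contMDiff hu.neg
  have hpos : ∀ x, 0 < Real.exp (-u x) := fun x ↦ Real.exp_pos _
  have hconf' : ∀ (x : M) (v w : TangentSpace (𝓡 4) x),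
      h.val x v w = Real.exp (-u x) ^ 2 * g.val x v w := by
    intro x v w
    rw [hconf x v w, sq, ← Real.exp_add]
    congr 2
    ring
  have h1 : h.sigma2WeylSchoutenIntegral = g.sigma2WeylSchoutenIntegral :=
    sigma2WeylSchoutenIntegral_conformal g h hg hψ hpos hconf'
  have h2 : h.weylEnergy = g.weylEnergy := weylEnergy_conformal_sq_four g h hg hψ hpos hconf'
  simp only [kappa, h1, h2]

/-- **The continuity method** (GV 2003, §5, with the Weyl weight): from STUBS 2–6, THEOREM 1.4 IN
THE PSC SHAPE — the conclusion is `Disproof.Thm14LeafPsc` (= card gv-continuity-path's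
`thm14_gurskyViaclovsky`) at `(M, g)`: closed CONNECTED `M⁴`, `R_g > 0`, `¼∫|W|² < ∫σ₂(A)` ⇒ a
conformal metric with `R > 0` and `¼|W|² < σ₂(A)` pointwise. `𝒮 = {t | Solvable g t q}` with
`q = P_δ(g)`: `δ ∈ 𝒮` (STUB 3), `𝒮 ∩ [δ,1]` is closed (STUB 4 with `κ₀ = κ(g)`, constant along
solutions by STUB 2, + STUB 6) and relatively open below `1` (STUB 5), so `1 ∈ 𝒮`
(`IsClosed.mem_of_ge_of_forall_exists_gt`); a solution at `t = 1` is the conformal metric sought.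
[cite: GurskyViaclovsky2003, §5] [cite: ChangGurskyYang2003, Thm. 1.4] -/
theorem thm14Psc_of_path [ConnectedSpace M]
    (g : PseudoRiemannianMetric (𝓡 4) ∞ (EuclideanSpace ℝ (Fin 4)) (TangentSpace (𝓡 4) : M → Type _))
    [g.HasLeviCivita] (hg : g.IsRiemannian) (hR : ∀ x, 0 < g.scalarCurvature x)
    (h12 : 1 / 4 * g.weylEnergy.toReal < g.sigma2WeylSchoutenIntegral) :
    ∃ (h : PseudoRiemannianMetric (𝓡 4) ∞ (EuclideanSpace ℝ (Fin 4)) (TangentSpace (𝓡 4) : M → Type _))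
      (_ : h.HasLeviCivita) (hh : h.IsRiemannian),
      IsConformalTo (h.toContMDiffRiemannianMetric hh) (g.toContMDiffRiemannianMetric hg) ∧
      (∀ x, 0 < h.scalarCurvature x) ∧ ∀ x, 1 / 4 * h.weylNormSq x < h.sigma2WeylSchouten x := by
  have hκ : 0 < kappa g := by unfold kappa; linarith
  -- STUB 3: the start `δ`, the right side `q := P_δ(g)`, and `δ ∈ 𝒮`
  obtain ⟨δ, hδ1, hqs, hqpos⟩ := stub_pathStart M g hg hR
  set q : M → ℝ := fun x ↦ pathOperator g δ x with hq
  set S : Set ℝ := {t | Solvable g t q} with hS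
  have hδS : δ ∈ S := ⟨g, ‹g.HasLeviCivita›, fun _ ↦ 0, isPathSolution_start g hg hR δ⟩
  -- STUB 4: the uniform bound, with `κ₀ := κ(g)`, valid for every solution since `κ(h) = κ(g)`
  obtain ⟨C, hC⟩ := stub_pathApriori M g hg q δ (kappa g) hqs hqpos hδ1 hκ
  have hbound : ∀ t : ℝ, δ ≤ t → t ≤ 1 →
      ∀ (h : PseudoRiemannianMetric (𝓡 4) ∞ (EuclideanSpace ℝ (Fin 4)) (TangentSpace (𝓡 4) : M → Type _))
        [h.HasLeviCivita] (u : M → ℝ), IsPathSolution g h u t q →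
        ∀ x, |u x| ≤ C ∧ g.gradSq u x ≤ C ∧ g.normSq x (g.hessian u x) ≤ C :=
    fun t hδt ht1 h _ u hsol ↦ hC t hδt ht1 h u hsol (kappa_eq_of_isPathSolution g h hg hsol).ge
  -- STUB 6: `𝒮 ∩ [δ, 1]` is closed
  have hclosed : IsClosed (S ∩ Icc δ 1) := by
    refine IsSeqClosed.isClosed fun s t hs hst ↦ ?_
    have hsδ : ∀ k, δ ≤ s k := fun k ↦ (hs k).2.1
    have hs1 : ∀ k, s k ≤ 1 := fun k ↦ (hs k).2.2
    refine ⟨?_, ge_of_tendsto' hst hsδ, le_of_tendsto' hst hs1⟩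
    refine stub_pathClosed M g hg q C hqs hqpos s t hst hs1 fun k ↦ ?_
    obtain ⟨h, hLC, u, hsol⟩ := (hs k).1
    exact ⟨h, hLC, u, hsol, hbound (s k) (hsδ k) (hs1 k) h u hsol⟩
  -- STUB 5 + the continuity-method lemma: `1 ∈ 𝒮`
  have h1S : (1 : ℝ) ∈ S := by
    refine hclosed.mem_of_ge_of_forall_exists_gt hδS hδ1 fun x hx ↦ ?_
    obtain ⟨hxS, -, hx1⟩ := hx
    obtain ⟨ε, hε, hε'⟩ := stub_pathOpen M g hg q hqs hqpos x hx1.le hxS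
    refine ⟨min (x + ε / 2) 1, hε' _ ?_ ?_ (min_le_right _ _), lt_min (by linarith) hx1,
      min_le_right _ _⟩
    · have : x < min (x + ε / 2) 1 := lt_min (by linarith) hx1
      linarith
    · exact (min_le_left _ _).trans_lt (by linarith)
  -- the solution at `t = 1` is the conformal metric sought
  obtain ⟨h, hLC, u, hh, hu, hconf, hRh, heq⟩ := h1S
  refine ⟨h, hLC, hh, ?_, hRh, fun x ↦ ?_⟩
  · exact ⟨fun x ↦ Real.exp (-2 * u x), fun x ↦ ⟨Real.exp_pos _, fun v w ↦ by
      simp only [toContMDiffRiemannianMetric_inner, hconf x v w]⟩⟩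
  · have hx := heq x
    have hqx : 0 < q x * Real.exp (8 * u x) := mul_pos (hqpos x) (Real.exp_pos _)
    simp only [pathOperator] at hx
    nlinarith [hx, hqx]

end Composition

/-- **THE SKELETON THEOREM**: the crux, concluded BY NAME
(`Summit.SmoothPoincare4.SmoothPoincare4.Theses.EntropyRung.ChangGurskyYang`), closed modulo the six
registered stubs — no `sorry` here; `stub_margerin` and `stub_chernGaussBonnet` are consumed below,
`stub_chernGaussBonnet` (again, for `κ`), `stub_pathStart`, `stub_pathApriori`, `stub_pathOpen`,
`stub_pathClosed` inside `thm14Psc_of_path`. Proof = CGY 2003, §2 (p. 121) with Thm. 1.4 in the psc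
shape (the proof of `Disproof.crux_of_leaves_psc` with the CGB leaf in Euler form): `(0.3) ⇒ (1.2)`
by Chern–Gauss–Bonnet (STUB 2) and `χ(M) ≥ 2` (`quarter_weylEnergy_lt_of_chernGaussBonnet`,
topological half PROVED in the tree), the path gives a conformal `g'` with `R > 0` and
`σ₂(A) − ¼|W|² > 0`, "rearranging terms" gives `WP < 1/6` (`weakPinching_lt_of_sigma2WeylSchouten_gt`),
Margerin (STUB 1) gives `S⁴ ∨ ℝP⁴`, and `π₁ = 1` excludes `ℝP⁴`
(`IsRealProjectiveSpace.not_simplyConnectedSpace`). [cite: ChangGurskyYang2003, §2, p. 121]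
[cite: GurskyViaclovsky2003, Thm. 1] -/
theorem ChangGurskyYang_of : ChangGurskyYang := by
  rintro M _ _ _ _ _ _ _ ⟨g, _, hgR, hscal, hW⟩
  have hE : Module.finrank ℝ (EuclideanSpace ℝ (Fin 4)) = 4 := finrank_euclideanSpace_fin
  -- (0.3) ⇒ (1.2) by the Chern–Gauss–Bonnet leaf (STUB 2) and `χ(M) ≥ 2`
  have h12 : 1 / 4 * g.weylEnergy.toReal < g.sigma2WeylSchoutenIntegral :=
    quarter_weylEnergy_lt_of_chernGaussBonnet g hgR (stub_chernGaussBonnet M g hgR) hW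
  -- Thm. 1.4 (connected, psc shape) by the weighted GV path (STUBS 2–6): `g'` conformal, `R > 0`,
  -- `σ₂(A) > ¼|W|²` pointwise
  obtain ⟨g', _, hg'R, -, hscal', hpt⟩ := thm14Psc_of_path g hgR hscal h12
  have hpos' : ∀ (x : M) (v : TangentSpace (𝓡 4) x), v ≠ 0 → 0 < g'.val x v v :=
    fun x v hv ↦ hg'R x v hv
  -- "Rearranging terms": `WP < 1/6` pointwise
  have hWP : ∀ x, g'.weakPinching x < 1 / 6 := fun x ↦
    g'.weakPinching_lt_of_sigma2WeylSchouten_gt (WithTop.coe_le_coe.mpr le_top) hE (hpos' x) (hpt x)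
  -- Margerin (STUB 1): `S⁴` or `ℝP⁴`; `π₁ = 1` excludes `ℝP⁴`
  rcases stub_margerin M g' hg'R hscal' hWP with h | h
  · exact h
  · exact absurd ‹SimplyConnectedSpace M› (h.not_simplyConnectedSpace (by norm_num))

/-- The same skeleton theorem for the SECOND route wanting this shared item (route WeylBudget, rank 9:
`WeylBudget.ChangGurskyYang` is the identical proposition, `Disproof.weylBudget_crux_iff : _ ↔ _ :=
Iff.rfl`), so that the skeleton audit passes whichever route's decl the crux item resolves to.
[cite: ChangGurskyYang2003, Thm. A] -/
theorem ChangGurskyYang_of_weylBudget :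
    Summit.SmoothPoincare4.SmoothPoincare4.Theses.WeylBudget.ChangGurskyYang :=
  ChangGurskyYang_of

/-! ## Scratch checks against the LANDED negative lemmas (Disproof §3a/§3b)

Both refute the crux with a binder DELETED; every stub above keeps `[CompactSpace M]`, and the only
statement over non-simply-connected `M` that concludes a diffeomorphism type (`stub_margerin`) says
`S⁴ ∨ ℝP⁴` — so no stub is an instance of either refuted shape. -/

example := Summit.SmoothPoincare4.SmoothPoincare4.Theorems.ChangGurskyYang.Negative.changGurskyYang_false_without_compact
example := Summit.SmoothPoincare4.SmoothPoincare4.Theorems.ChangGurskyYang.Negative.changGurskyYang_false_without_simplyConnected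

end Summit.SmoothPoincare4.SmoothPoincare4.Cruxes.ChangGurskyYang.GvContinuityPath

end
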